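import Summits.CriticalPhenomena.PercolationContinuityZ3.Theorems.PercNearOneGluingNoHeavyQuantZ2PolyDecay
import Summits.CriticalPhenomena.PercolationContinuityZ3.Theorems.PercNearOneGluingNoHeavyQuantOneArmSteepness
import Literature.Probability.Percolation.HarrisTheorem
import HarnessLib

/-!
# CRITICAL BERNOULLI FIRST-PASSAGE PERCOLATION ON `ℤ²` IS AT LEAST LOGARITHMIC: `E_{1/2}[T_N] ≥ 2⁻¹⁵⁶·K` whenever `3·4^K ≤ N`
# (`T_N` = minimal number of closed edges on a lattice path `0 → ∂Λ_N`; Chayes–Chayes–Durrett's lower bound with Bollobás–Riordan's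
# RSW constant), hence `E_{1/2}[T_N] ≥ 2⁻¹⁵⁶·⌊log₄(N/3)⌋`, and by exponential steepness `θ_N(r) ≤ θ_N(1/2)·exp(−2⁻¹⁵⁴(1/2 − r)·K)` for `r < 1/2`
# — quant lane, METHOD = differential inequalities (steepness + Bernoulli FPP), seat p4 gen 33, file 11

builds on p205010 (kernel theorem, internal audit signed; external expert review pending) — NOT used in this file (on `ℤ²`, `θ(1/2) = 0` is
Harris–Kesten; here only RSW at `p = 1/2` enters).

Seat `prim-quant-p4`, `--supports stmt-CriticalPhenomena-4575`; pure proofs, no definitions (`local notation3` only).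
`T_N`, `E_p[T_N] = PassTime.meanPassTime 2 N p` (gen 20: `{T_N ≤ k} = PassTime.passTimeLE 2 N k`), `annulusBlocked m` = the square annulus
`{m ≤ ‖z‖∞ ≤ 3m}` has no short-way open crossing of its four rectangles (tree, Harris's theorem file), `half = 1/2`, `θ_N(r) = DCT16.thetaN 2 N r`.

THE ARGUMENT (Chayes–Chayes–Durrett 1986 lower bound, in Bollobás–Riordan's annulus form).  The annuli `A_k = {4^{k+1} ≤ ‖z‖∞ ≤ 3·4^{k+1}}`,
`k < K`, have pairwise disjoint bond sets and fit inside `Λ_N` when `3·4^K ≤ N`; each is blocked (carries a closed dual circuit) with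
probability `≥ 2⁻¹⁵⁶` at `p = 1/2` (tree `Quant.le_real_annulusBlocked_half`, from `h(7n,2n) ≥ 2⁻³⁹`).  If `B(ω)` of them are blocked, then
opening any set `S` of fewer than `B(ω)` lattice edges leaves some blocked annulus untouched (pigeonhole on disjoint bond sets; `annulusBlocked`
is determined by the annulus bonds), which still confines the cluster of the origin inside `Λ_N` (`Quant.not_mem_siteToBoundary_of_annulusBlocked`):
so `T_N(ω) ≥ B(ω)` (§2), and `E_{1/2}[T_N] ≥ E[B] = Σ_{k<K} P(A_k blocked) ≥ 2⁻¹⁵⁶K` (§3, layer cake).  Gen 20 proved `E_{p_c}[T_N] → ∞` in every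
`d ≥ 2` from `θ(p_c) = 0` without a rate; on `ℤ²` the rate is at least logarithmic with an explicit (absurdly small) constant.  Consequences
(§4): with gen 20's exponential steepness `θ_N(r) ≤ θ_N(s)·exp(−4(s−r)E_s[T_N])` at `s = 1/2`:
**`θ_N(r) ≤ θ_N(1/2)·exp(−2⁻¹⁵⁴(1/2 − r)·K)`** for `0 < r ≤ 1/2`, `3·4^K ≤ N` — a polynomial-in-`N` gain `N^{−c(1/2−r)}` of the subcritical
one-arm probability over the critical one (of course weaker than the exponential decay known below `p_c`; recorded as the explicit form of
steepness at criticality); the same factor multiplies the two-point function by gen 33 file 8 (`TauSteep.tau_le_tau_criticalProbI_mul_exp`).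

* §1 `CritFPP.annulusEdges_disjoint`, `annulus_sym2_subset_edgesIn`, `blocked_of_union_disjoint`.
* §2 **`CritFPP.not_mem_passTimeLE_of_lt_blockedCount`** (`k < B(ω) ⟹ T_N(ω) > k`, lattice `ω`).
* §3 `CritFPP.blockedCount_eq_sum_indicator`, `sum_real_blockedCount_gt`, **`meanPassTime_half_ge`** (`E_{1/2}[T_N] ≥ 2⁻¹⁵⁶K`, `3·4^K ≤ N`),
  **`meanPassTime_half_ge_log`** (`≥ 2⁻¹⁵⁶·⌊log₄(N/3)⌋`), `meanPassTime_criticalProbI_two_ge`.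
* §4 **`CritFPP.thetaN_le_thetaN_half_mul_exp`**.

HONEST STATUS.  Reproduction-level (CCD 1986 lower half via BR06's annuli; the matching `O(log N)` upper bound and the exact order are not
attempted); explicit constant `2⁻¹⁵⁶` inherited from the tree's RSW numeral; new as typed.  No statement for `d ≥ 3`; (T1)/(T2) and the honest
sentence UNCHANGED.

## References
* J. T. Chayes, L. Chayes, R. Durrett, *Critical behavior of the two-dimensional first passage time*, J. Stat. Phys. 45 (1986) 933–951 [ChayesChayesDurrett1986].
* B. Bollobás, O. Riordan, *Percolation* (2006), Ch. 3, Thm. 6 and eq. (3)–(5) [BollobasRiordan2006].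
* G. Grimmett, *The Random-Cluster Model* (2006), Thm. (2.53) (2.56) [GrimmettRandomCluster2006].
-/

noncomputable section

namespace Summit.CriticalPhenomena.PercolationContinuityZ3.Theorems

open MeasureTheory Set Filter Topology Literature.Probability.Percolation Literature.Probability.LatticeModels
open scoped Classical

namespace CritFPP

/-- The bond set of the `k`-th annulus `{4^{k+1} ≤ ‖z‖∞ ≤ 3·4^{k+1}}` (as in `determinedBy_annulusBlocked`). -/
local notation3 "AE[" k "]" => ((annulus 2 (4 ^ (k + 1) - 1) (3 * 4 ^ (k + 1))).sym2 : Finset (Sym2 (Site 2)))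

/-- `B_K(ω) = #{k < K : ω ∈ annulusBlocked 4^{k+1}}`, the number of blocked annuli among the first `K`. -/
local notation3 "BC[" K ", " ω "]" => (((Finset.range K).filter fun k : ℕ => ω ∈ annulusBlocked (4 ^ (k + 1))).card : ℕ)

/-! ### §1. The annuli: disjoint bond sets inside `Λ_N` -/

/-- `4^{k+1} ≥ 2`. [folklore] -/
theorem two_le_four_pow_succ (k : ℕ) : 2 ≤ 4 ^ (k + 1) :=
  le_trans (by norm_num) (Nat.pow_le_pow_right (by norm_num) (Nat.succ_le_succ (Nat.zero_le k)))

/-- The bond sets of distinct annuli are disjoint. [cite: BollobasRiordan2006, Ch. 3, proof of Thm. 6 ("the A_k are disjoint")] -/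
theorem annulusEdges_disjoint {j k : ℕ} (hjk : j ≠ k) : Disjoint (AE[j]) (AE[k]) := by
  wlog hlt : j < k generalizing j k
  · exact (this hjk.symm (lt_of_le_of_ne (not_lt.1 hlt) hjk.symm)).symm
  have hsub : AE[j] ⊆ (box 2 (3 * 4 ^ (j + 1))).sym2 := Finset.sym2_mono (Finset.sdiff_subset)
  have hm : 3 * 4 ^ (j + 1) < 4 ^ (k + 1) := by
    calc 3 * 4 ^ (j + 1) < 4 * 4 ^ (j + 1) := by
          have : 0 < 4 ^ (j + 1) := by positivity
          omega
      _ = 4 ^ (j + 2) := by ring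
      _ ≤ 4 ^ (k + 1) := Nat.pow_le_pow_right (by norm_num) (by omega)
  have h := disjoint_sym2_box_sym2_annulus (m := 3 * 4 ^ (j + 1)) (n := 4 ^ (k + 1)) hm
  rw [Finset.disjoint_coe] at h
  exact h.mono_left hsub

/-- The annulus bonds that are lattice edges lie in `F_N = edgesIn (zdGraph 2) (box 2 N)` when `3·4^{k+1} ≤ N`. [folklore] -/
theorem mem_edgesIn_of_mem_annulusEdges {k N : ℕ} (hN : 3 * 4 ^ (k + 1) ≤ N) {e : Sym2 (Site 2)} (he : e ∈ AE[k])
    (heE : e ∈ (zdGraph 2).edgeSet) : e ∈ edgesIn (zdGraph 2) (box 2 N) := by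
  rw [mem_edgesIn_iff]
  refine ⟨heE, fun x hx => ?_⟩
  have hx' : x ∈ annulus 2 (4 ^ (k + 1) - 1) (3 * 4 ^ (k + 1)) := Finset.mem_sym2_iff.1 he x hx
  exact box_mono 2 hN (Finset.sdiff_subset hx')

/-- **Opening a bond set disjoint from an annulus keeps it blocked** (`annulusBlocked` is determined by the annulus bonds).
[cite: BollobasRiordan2006, Ch. 3, proof of Thm. 6] -/
theorem blocked_of_union_disjoint {k : ℕ} {ω : BondConfig (Site 2)} (hB : ω ∈ annulusBlocked (4 ^ (k + 1))) {S : Finset (Sym2 (Site 2))}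
    (hS : ∀ e ∈ S, e ∉ AE[k]) : ω ∪ ↑S ∈ annulusBlocked (4 ^ (k + 1)) := by
  have hdet := determinedBy_annulusBlocked (n := 4 ^ (k + 1)) (le_trans (by norm_num) (two_le_four_pow_succ k))
  rw [determinedBy_iff] at hdet
  refine (hdet ω (ω ∪ ↑S) ?_).1 hB
  ext e
  simp only [Set.mem_inter_iff, Set.mem_union, Finset.mem_coe]
  constructor
  · rintro ⟨he, heA⟩; exact ⟨Or.inl he, heA⟩
  · rintro ⟨he | he, heA⟩
    · exact ⟨he, heA⟩
    · exact absurd heA (hS e he)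

/-! ### §2. Blocked annuli bound the passage time from below -/

/-- **`k < B_K(ω) ⟹ T_N(ω) > k`** for a lattice configuration `ω` and `3·4^K ≤ N`: fewer than `B_K(ω)` opened bonds miss some blocked annulus
(pigeonhole over the disjoint bond sets), which then still confines the cluster of the origin strictly inside `Λ_N`.
[cite: ChayesChayesDurrett1986, §1 (lower bound)] [cite: BollobasRiordan2006, Ch. 3, proof of Thm. 6] -/
theorem not_mem_passTimeLE_of_lt_blockedCount {ω : BondConfig (Site 2)} (hω : ω ⊆ (zdGraph 2).edgeSet) {K N k : ℕ}
    (hN : 3 * 4 ^ K ≤ N) (hk : k < BC[K, ω]) : ω ∉ PassTime.passTimeLE 2 N k := by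
  rintro ⟨S, hSF, hSk, hA⟩
  set J : Finset ℕ := (Finset.range K).filter fun j : ℕ => ω ∈ annulusBlocked (4 ^ (j + 1)) with hJ
  -- some blocked annulus receives no bond of `S`
  have hex : ∃ j ∈ J, ∀ e ∈ S, e ∉ AE[j] := by
    by_contra hcon
    push Not at hcon
    choose f hf using hcon
    -- `f : ∀ j ∈ J, Sym2 (Site 2)` with `f j ∈ S ∩ AE[j]`; it is injective, so `|J| ≤ |S| ≤ k < |J|`
    have hinj : Set.InjOn (fun j => if hj : j ∈ J then f j hj else s((0 : Site 2), 0)) ↑J := by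
      intro j hj j' hj' hff
      simp only [Finset.mem_coe] at hj hj'
      simp only [hj, hj', dif_pos] at hff
      by_contra hne
      have hd := annulusEdges_disjoint (j := j) (k := j') hne
      exact Finset.disjoint_left.1 hd (hf j hj).2 (hff ▸ (hf j' hj').2)
    have hmaps : Set.MapsTo (fun j => if hj : j ∈ J then f j hj else s((0 : Site 2), 0)) ↑J ↑S := by
      intro j hj
      simp only [Finset.mem_coe] at hj ⊢
      simp only [hj, dif_pos]
      exact (hf j hj).1
    have hcard : J.card ≤ S.card := Finset.card_le_card_of_injOn _ hmaps hinj
    omega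
  obtain ⟨j, hjJ, hjS⟩ := hex
  have hjK : j < K := Finset.mem_range.1 (Finset.mem_filter.1 hjJ).1
  have hjB : ω ∈ annulusBlocked (4 ^ (j + 1)) := (Finset.mem_filter.1 hjJ).2
  have hB' : ω ∪ ↑S ∈ annulusBlocked (4 ^ (j + 1)) := blocked_of_union_disjoint hjB hjS
  have hη : ω ∪ ↑S ⊆ (zdGraph 2).edgeSet := Set.union_subset hω ((Finset.coe_subset.2 hSF).trans (DKT20.coe_edgesIn_subset N))
  have h3 : 3 * 4 ^ (j + 1) ≤ N := le_trans (Nat.mul_le_mul_left 3 (Nat.pow_le_pow_right (by norm_num) hjK)) hN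
  have hnot := Quant.not_mem_siteToBoundary_of_annulusBlocked hη (le_trans (by norm_num) (two_le_four_pow_succ j)) h3 hB'
  exact hnot ((PassTime.armEvent_zero_iff_siteToBoundary hη N).1 hA)

/-! ### §3. `E_{1/2}[T_N] ≥ 2⁻¹⁵⁶·K` -/

/-- `B_K` as a sum of indicators. [folklore] -/
theorem blockedCount_eq_sum_indicator (K : ℕ) (ω : BondConfig (Site 2)) :
    (BC[K, ω] : ℝ) = ∑ j ∈ Finset.range K, (annulusBlocked (4 ^ (j + 1))).indicator (1 : BondConfig (Site 2) → ℝ) ω := by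
  rw [Finset.card_filter]
  push_cast
  refine Finset.sum_congr rfl fun j _ => ?_
  by_cases h : ω ∈ annulusBlocked (4 ^ (j + 1))
  · rw [if_pos h, Set.indicator_of_mem h, Pi.one_apply]
  · rw [if_neg h, Set.indicator_of_notMem h]

/-- `ω ↦ B_K(ω)` is measurable. [folklore] -/
theorem measurable_blockedCount (K : ℕ) : Measurable fun ω : BondConfig (Site 2) => (BC[K, ω] : ℝ) := by
  have h : (fun ω : BondConfig (Site 2) => (BC[K, ω] : ℝ)) =
      fun ω => ∑ j ∈ Finset.range K, (annulusBlocked (4 ^ (j + 1))).indicator (1 : BondConfig (Site 2) → ℝ) ω :=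
    funext fun ω => blockedCount_eq_sum_indicator K ω
  rw [h]
  exact Finset.measurable_sum _ fun j _ => measurable_const.indicator (measurableSet_annulusBlocked _)

/-- **Layer cake + blocked annuli: `Σ_{k<K} P(B_K > k) = E[B_K] = Σ_{j<K} P(annulusBlocked 4^{j+1})`.** [folklore] -/
theorem sum_real_blockedCount_gt (p : unitInterval) (K : ℕ) :
    ∑ k ∈ Finset.range K, (bondPercolation (zdGraph 2) p).real {ω : BondConfig (Site 2) | k < BC[K, ω]} =
      ∑ j ∈ Finset.range K, (bondPercolation (zdGraph 2) p).real (annulusBlocked (4 ^ (j + 1))) := by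
  set μ := bondPercolation (zdGraph 2) p with hμ
  have hmeas : ∀ k : ℕ, MeasurableSet {ω : BondConfig (Site 2) | k < BC[K, ω]} := fun k => by
    have : {ω : BondConfig (Site 2) | k < BC[K, ω]} = {ω | (k : ℝ) < (BC[K, ω] : ℝ)} := by ext ω; simp only [Set.mem_setOf_eq, Nat.cast_lt]
    rw [this]; exact measurableSet_lt measurable_const (measurable_blockedCount K)
  -- both sides equal `∫ B_K`
  have hpt : ∀ ω : BondConfig (Site 2), (BC[K, ω] : ℝ) =
      ∑ k ∈ Finset.range K, ({ω' : BondConfig (Site 2) | k < BC[K, ω']}).indicator (1 : BondConfig (Site 2) → ℝ) ω := by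
    intro ω
    have hk : BC[K, ω] ≤ K := (Finset.card_filter_le _ _).trans (Finset.card_range K).le
    have hcount : ((Finset.range K).filter fun k => k < BC[K, ω]) = Finset.range (BC[K, ω]) := by
      ext i; simp only [Finset.mem_filter, Finset.mem_range]; omega
    calc (BC[K, ω] : ℝ) = (((Finset.range K).filter fun k => k < BC[K, ω]).card : ℝ) := by rw [hcount, Finset.card_range]
      _ = ∑ k ∈ Finset.range K, (if k < BC[K, ω] then (1 : ℝ) else 0) := by rw [Finset.card_filter]; push_cast; rfl
      _ = _ := Finset.sum_congr rfl fun k _ => by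
          by_cases h : k < BC[K, ω]
          · rw [if_pos h, Set.indicator_of_mem (by exact h), Pi.one_apply]
          · rw [if_neg h, Set.indicator_of_notMem (by exact h)]
  have hL : ∑ k ∈ Finset.range K, μ.real {ω : BondConfig (Site 2) | k < BC[K, ω]} = ∫ ω, (BC[K, ω] : ℝ) ∂μ := by
    simp_rw [hpt]
    have hint : ∀ k ∈ Finset.range K, Integrable (fun ω : BondConfig (Site 2) =>
        ({ω' : BondConfig (Site 2) | k < BC[K, ω']}).indicator (1 : BondConfig (Site 2) → ℝ) ω) μ :=
      fun k _ => (integrable_const (1 : ℝ)).indicator (hmeas k)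
    rw [integral_finsetSum _ hint]
    exact Finset.sum_congr rfl fun k _ => (integral_indicator_one (hmeas k)).symm
  have hR : ∑ j ∈ Finset.range K, μ.real (annulusBlocked (4 ^ (j + 1))) = ∫ ω, (BC[K, ω] : ℝ) ∂μ := by
    simp_rw [blockedCount_eq_sum_indicator K]
    have hint : ∀ j ∈ Finset.range K, Integrable (fun ω : BondConfig (Site 2) =>
        (annulusBlocked (4 ^ (j + 1))).indicator (1 : BondConfig (Site 2) → ℝ) ω) μ :=
      fun j _ => (integrable_const (1 : ℝ)).indicator (measurableSet_annulusBlocked _)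
    rw [integral_finsetSum _ hint]
    exact Finset.sum_congr rfl fun j _ => (integral_indicator_one (measurableSet_annulusBlocked _)).symm
  rw [hL, hR]

/-- **CRITICAL FIRST-PASSAGE PERCOLATION ON `ℤ²`: `E_{1/2}[T_N] ≥ 2⁻¹⁵⁶·K` whenever `3·4^K ≤ N`.**
[cite: ChayesChayesDurrett1986, §1 (lower bound)] [cite: BollobasRiordan2006, Ch. 3, Thm. 6 and eq. (5)] -/
theorem meanPassTime_half_ge {K N : ℕ} (hN : 3 * 4 ^ K ≤ N) : (2 : ℝ)⁻¹ ^ 156 * K ≤ PassTime.meanPassTime 2 N half := by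
  set μ := bondPercolation (zdGraph 2) half with hμ
  -- `K ≤ |F_N|`: the axis bonds `{(j,0),(j+1,0)}`, `j < K`, lie in `Λ_N`… we use the cruder `K ≤ 3·4^K ≤ N ≤ |F_N|` via `T_N ≤ |F_N|`-type facts:
  have hKF : K ≤ (edgesIn (zdGraph 2) (box 2 N)).card := by
    -- `F_N` contains the `N` distinct bonds `{(j,0),(j+1,0)}`, `0 ≤ j < N`
    have hKN : K ≤ N := le_trans (le_trans (Nat.lt_pow_self (by norm_num : 1 < 4)).le (Nat.le_mul_of_pos_left _ (by norm_num))) hN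
    refine le_trans hKN ?_
    let f : ℕ → Sym2 (Site 2) := fun j => s(![(j : ℤ), 0], ![(j : ℤ) + 1, 0])
    have hf : ∀ j ∈ Finset.range N, f j ∈ edgesIn (zdGraph 2) (box 2 N) := by
      intro j hj
      rw [Finset.mem_range] at hj
      rw [mem_edgesIn_iff]
      refine ⟨?_, fun x hx => ?_⟩
      · rw [SimpleGraph.mem_edgeSet, zdGraph_adj_iff]
        refine ⟨0, Or.inl ?_⟩
        funext i; fin_cases i <;> simp
      · rcases Sym2.mem_iff.1 hx with rfl | rfl
        · rw [mem_box]; intro i; fin_cases i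
          · simp; omega
          · simp
        · rw [mem_box]; intro i; fin_cases i
          · simp; omega
          · simp
    have hinj : Set.InjOn f ↑(Finset.range N) := by
      intro a _ b _ hab
      have h := Sym2.eq_iff.1 hab
      rcases h with ⟨h1, -⟩ | ⟨h1, h2⟩
      · have := congrFun h1 0; simpa using this
      · have := congrFun h1 0; have := congrFun h2 0; simp at *; omega
    calc N = (Finset.range N).card := (Finset.card_range N).symm
      _ ≤ (edgesIn (zdGraph 2) (box 2 N)).card := Finset.card_le_card_of_injOn f hf hinj
  -- `E[T_N] ≥ Σ_{k<K} P(T_N > k) ≥ Σ_{k<K} P(B_K > k) = Σ_j P(blocked_j) ≥ 2⁻¹⁵⁶ K`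
  calc (2 : ℝ)⁻¹ ^ 156 * K = ∑ _j ∈ Finset.range K, (2 : ℝ)⁻¹ ^ 156 := by rw [Finset.sum_const, Finset.card_range, nsmul_eq_mul, mul_comm]
    _ ≤ ∑ j ∈ Finset.range K, μ.real (annulusBlocked (4 ^ (j + 1))) :=
        Finset.sum_le_sum fun j _ => Quant.le_real_annulusBlocked_half _ (two_le_four_pow_succ j)
    _ = ∑ k ∈ Finset.range K, μ.real {ω : BondConfig (Site 2) | k < BC[K, ω]} := (sum_real_blockedCount_gt half K).symm
    _ ≤ ∑ k ∈ Finset.range K, (1 - μ.real (PassTime.passTimeLE 2 N k)) := by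
        refine Finset.sum_le_sum fun k _ => ?_
        rw [← probReal_compl_eq_one_sub (PassTime.measurableSet_passTimeLE 2 N k), measureReal_def, measureReal_def]
        refine ENNReal.toReal_mono (measure_ne_top _ _) (measure_mono_ae ?_)
        filter_upwards [ae_subset_edgeSet (zdGraph 2) half] with ω hω hk
        exact not_mem_passTimeLE_of_lt_blockedCount hω hN hk
    _ ≤ PassTime.meanPassTime 2 N half := by
        rw [PassTime.meanPassTime]
        exact Finset.sum_le_sum_of_subset_of_nonneg (Finset.range_mono hKF) fun k _ _ => PassTime.one_sub_real_passTimeLE_nonneg half N k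

/-- **`E_{1/2}[T_N] ≥ 2⁻¹⁵⁶·⌊log₄(N/3)⌋`** for every `N` (critical Bernoulli FPP on `ℤ²` grows at least logarithmically).
[cite: ChayesChayesDurrett1986, §1 (lower bound)] [cite: BollobasRiordan2006, Ch. 3, Thm. 6] -/
theorem meanPassTime_half_ge_log (N : ℕ) : (2 : ℝ)⁻¹ ^ 156 * Nat.log 4 (N / 3) ≤ PassTime.meanPassTime 2 N half := by
  rcases Nat.eq_zero_or_pos (N / 3) with h0 | hpos
  · rw [h0, Nat.log_zero_right, Nat.cast_zero, mul_zero]; exact PassTime.meanPassTime_nonneg half N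
  · refine meanPassTime_half_ge (K := Nat.log 4 (N / 3)) ?_
    have := Nat.pow_log_le_self 4 hpos.ne'
    omega

/-- The same at the tree's `criticalProbI 2` (`= 1/2`, Kesten). [cite: ChayesChayesDurrett1986, §1] [cite: Kesten1982, §3.3] -/
theorem meanPassTime_criticalProbI_two_ge (N : ℕ) :
    (2 : ℝ)⁻¹ ^ 156 * Nat.log 4 (N / 3) ≤ PassTime.meanPassTime 2 N (criticalProbI 2) := by
  have h : criticalProbI 2 = half := by
    ext; rw [coe_criticalProbI, kesten_criticalProb_Z2_holds]; rfl
  rw [h]; exact meanPassTime_half_ge_log N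

/-! ### §4. Steepness at criticality with the logarithmic passage time -/

/-- **`θ_N(r) ≤ θ_N(1/2)·exp(−2⁻¹⁵⁴·(1/2 − r)·K)`** for `0 < r ≤ 1/2` and `3·4^K ≤ N` (gen 20's exponential steepness at `s = 1/2` with §3):
the subcritical one-arm probability is at most the critical one times `N^{−c(1/2−r)}`.
[cite: GrimmettRandomCluster2006, Thm. (2.53) eq. (2.56)] [cite: ChayesChayesDurrett1986, §1] -/
theorem thetaN_le_thetaN_half_mul_exp {K N : ℕ} (hN : 3 * 4 ^ K ≤ N) {r : ℝ} (hr : 0 < r) (hrh : r ≤ 1 / 2) :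
    DCT16.thetaN 2 N r ≤ DCT16.thetaN 2 N (1 / 2) * Real.exp (-(2 : ℝ)⁻¹ ^ 154 * (1 / 2 - r) * K) := by
  have h := PassTime.thetaN_le_thetaN_mul_exp (d := 2) N hr hrh (by norm_num : (1 / 2 : ℝ) < 1)
  have hprm : (Set.projIcc (0 : ℝ) 1 zero_le_one (1 / 2 : ℝ)) = half :=
    Subtype.ext (congrArg Subtype.val (Set.projIcc_of_mem zero_le_one (show (1 / 2 : ℝ) ∈ Set.Icc (0 : ℝ) 1 by
      constructor <;> norm_num)))
  rw [hprm] at h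
  refine h.trans (mul_le_mul_of_nonneg_left (Real.exp_le_exp.2 ?_) ?_)
  · have hT := meanPassTime_half_ge hN
    have hsr : 0 ≤ 1 / 2 - r := by linarith
    have : (2 : ℝ)⁻¹ ^ 154 = 4 * (2 : ℝ)⁻¹ ^ 156 := by norm_num
    rw [this]
    nlinarith [mul_le_mul_of_nonneg_left hT (by positivity : (0 : ℝ) ≤ 4 * (1 / 2 - r))]
  · simp only [DCT16.thetaN]; exact measureReal_nonneg

/-! ### §5. Logarithmic steepness of the one-arm probability at `p_c(ℤ²)` -/

/-- **`2⁻¹⁵⁴·⌊log₄(N/3)⌋·θ_N(1/2) ≤ θ_N'(1/2)` on `ℤ²`**: the logarithmic derivative of the one-arm probability at criticality is at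
least `2⁻¹⁵⁴·log₄(N/3)` (gen 20's derivative-form steepness `θ_N·E_{1/2}[T_N] ≤ ¼·θ_N'(1/2)` with §3).
[cite: GrimmettRandomCluster2006, Thm. (2.53) eq. (2.54)] [cite: ChayesChayesDurrett1986, §1] -/
theorem deriv_thetaN_half_ge_log (N : ℕ) :
    (2 : ℝ)⁻¹ ^ 154 * Nat.log 4 (N / 3) * DCT16.thetaN 2 N (1 / 2) ≤ deriv (DCT16.thetaN 2 N) (1 / 2) := by
  have h := PassTime.thetaN_mul_meanPassTime_le_deriv (d := 2) N
    (show (1 / 2 : ℝ) ∈ Set.Ioo (0 : ℝ) 1 by constructor <;> norm_num)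
  have hprm : (Set.projIcc (0 : ℝ) 1 zero_le_one (1 / 2 : ℝ)) = half :=
    Subtype.ext (congrArg Subtype.val (Set.projIcc_of_mem zero_le_one (show (1 / 2 : ℝ) ∈ Set.Icc (0 : ℝ) 1 by
      constructor <;> norm_num)))
  rw [hprm] at h
  have hT := meanPassTime_half_ge_log N
  have hθ : 0 ≤ DCT16.thetaN 2 N (1 / 2) := by simp only [DCT16.thetaN]; exact measureReal_nonneg
  have hmul := mul_le_mul_of_nonneg_left hT hθ
  have : (2 : ℝ)⁻¹ ^ 154 = 4 * (2 : ℝ)⁻¹ ^ 156 := by norm_num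
  rw [this]
  nlinarith [hmul, h]

end CritFPP

end Summit.CriticalPhenomena.PercolationContinuityZ3.Theorems

end
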